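import Literature.NumberTheory.GaloisRepresentations.ContinuousH2
import HarnessLib

/-!
# Continuous cohomology in degree three: inhomogeneous cocycles

The degree-`3` companion of `ContinuousH2.lean`: the classical description of Mathlib's
`continuousCohomology 3 X` (homology of the `G`-invariant homogeneous continuous cochains) by
**continuous inhomogeneous `3`-cocycles**, for a locally compact topological group `G` and an
arbitrary topological representation `X` (Serre, *Cohomologie galoisienne*, I §2.2–2.3;
Neukirch–Schmidt–Wingberg, *Cohomology of Number Fields*, I §2, II §7):

* `contThreeCocycles X` — continuous `f : G × G × G → X` with
  `σ f(τ, υ, ω) - f(στ, υ, ω) + f(σ, τυ, ω) - f(σ, τ, υω) + f(σ, τ, υ) = 0`;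
* `toThreeCochain X f` — the attached `G`-invariant homogeneous `3`-cochain
  `F(x, y, z, w) = x f(x⁻¹y, y⁻¹z, z⁻¹w)`, written in the action-free form
  `f(y, y⁻¹z, z⁻¹w) + f(x, x⁻¹y, y⁻¹w) - f(x, x⁻¹z, z⁻¹w) - f(x, x⁻¹y, y⁻¹z)`
  (`toThreeCochain_apply_eq_smul`); `d F = 0`;
* `threeCocycleClass X f ∈ H³_cont(G, X)` — its class; additive and `R`-linear, **surjective**
  (`threeCocycleClass_surjective`: the inhomogeneous cocycle of an invariant homogeneous cocycle
  `F` is `f(σ, τ, υ) = F(1, σ, στ, στυ)`), with kernel the **coboundaries of continuous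
  `2`-cochains** (`threeCocycleClass_eq_zero_iff`:
  `[f] = 0 ↔ ∃ b : C(G × G, X), f(σ, τ, υ) = σ b(τ, υ) - b(στ, υ) + b(σ, τυ) - b(σ, τ)`), and
  functorial along compatible pairs (`map_threeCocycleClass`);
* `ContPairing.cupCocycle₂₁ φ f g`, `ContPairing.cupCocycle₁₂ φ f g` — the cup products
  `Z² × Z¹ → Z³`, `(f ∪ g)(σ, τ, υ) = ⟨f(σ, τ), στ g(υ)⟩`, and `Z¹ × Z² → Z³`,
  `(f ∪ g)(σ, τ, υ) = ⟨f(σ), σ g(τ, υ)⟩`, along a continuous pairing `φ : X × Y → Z`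
  (Neukirch–Schmidt–Wingberg I §4), written action-free, together with the four vanishing
  statements `[f ∪ g] = 0` when either factor is a coboundary
  (`threeCocycleClass_cupCocycle₂₁_eq_zero_of_left/right`,
  `threeCocycleClass_cupCocycle₁₂_eq_zero_of_left/right`), i.e. the cup products
  `H² × H¹ → H³` and `H¹ × H² → H³` are well defined on classes;
* `dTwo X b` — the coboundary `(db)(σ, τ, υ) = σ b(τ, υ) - b(στ, υ) + b(σ, τυ) - b(σ, τ)` of a
  continuous `2`-cochain (`mem_contTwoCocycles_iff_dTwo`, `threeCocycleClass_eq_zero_iff_dTwo`),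
  the `2`-cocycle `contTwoCocycles.ofDTwoEq b ε = b - ε` attached to two cochains with `db = dε`
  and its behaviour under change of `b`, `ε`; the cochain cup product
  `ContPairing.cochainCup₁₁ φ α g = α ∪ g` of a `1`-cochain with a `1`-cocycle, the **Leibniz
  rule** `d(α ∪ g) = dα ∪ g` (`dTwo_cochainCup₁₁`, NSW (1.4.1)), and **Milne's `2`-cocycle**
  `ContPairing.cupSubCocycle = α ∪ g - ε` for `dε = dα ∪ g` (the local cocycle
  `(β_{1,v} - β_{v,1}) ∪ β'_v - ε_v` of *ADT* I Prop. 6.9), with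
  `twoCocycleClass_cupSubCocycle_of_mem : [α ∪ g - ε] = [α] ∪ [g] - [ε]` when `α`, `ε` are
  cocycles (the "first case").

This is the element-level `H³` needed for cochain constructions that pass through degree three:
the vanishing `d β₁ ∪ β' = d ε` in the definition of the Cassels–Tate pairing (Milne, *Arithmetic
Duality Theorems*, I Prop. 6.9) and of the Poitou–Tate pairing `Ш¹ × Ш² → ℚ/ℤ` (Milne I §4), and
`H³` statements of Poitou–Tate type (Milne I Thm. 4.10(c)).

## References

* J.-P. Serre, *Cohomologie galoisienne*, 5e éd., LNM 5 (1994) / *Galois Cohomology* (1997),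
  I §2.2 (continuous cochains, homogeneous and inhomogeneous), I §2.3. [SerreGaloisCohomology1997]
* J. Neukirch, A. Schmidt, K. Wingberg, *Cohomology of Number Fields*, 2nd ed. (2008), I §2,
  I §4 (cup products on inhomogeneous cochains), II §7. [NeukirchSchmidtWingberg2008]
* J. S. Milne, *Arithmetic Duality Theorems*, 2nd ed. (2006), I §4, I Prop. 6.9 (where `3`-cochains
  enter the arithmetic pairings). [MilneADT2006]
-/

noncomputable section

open CategoryTheory Limits Function

universe u v

namespace Literature.NumberTheory.GaloisRepresentations

open TopRep ContRepresentation ContinuousCohomology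

set_option allowUnsafeReducibility true in
attribute [local reducible] CategoryTheory.Functor.mapHomologicalComplex

/-! ### Homogeneous cochains in degrees three and four -/

section Cochains

variable {R : Type u} [CommRing R] [TopologicalSpace R]
variable {G : Type v} [Group G] [TopologicalSpace G] [IsTopologicalGroup G]
variable (X : TopRep.{v} R G)

/-- The fourth differential of Mathlib's standard resolution:
`(d F)(x)(y)(z)(w)(t) = F y z w t - (F x z w t - (F x y w t - (F x y z t - F x y z w)))`.
[folklore] -/
theorem d_four_hom_apply (F : C(G, C(G, C(G, C(G, X))))) (x y z w t : G) :
    (TopRep.d X 4).hom F x y z w t =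
      F y z w t - (F x z w t - (F x y w t - (F x y z t - F x y z w))) := rfl

/-- The action of `G` on `3`-cochains `C(G, C(G, C(G, C(G, X))))`:
`(g · F)(x, y, z, w) = g · F(g⁻¹x, g⁻¹y, g⁻¹z, g⁻¹w)`. [folklore] -/
theorem resolutionX_four_ρ_apply (g : G) (F : C(G, C(G, C(G, C(G, X))))) (x y z w : G) :
    ((resolutionX X 4).ρ g F : C(G, C(G, C(G, C(G, X))))) x y z w =
      X.ρ g (F (g⁻¹ * x) (g⁻¹ * y) (g⁻¹ * z) (g⁻¹ * w)) := rfl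

/-- `(ComplexShape.up ℕ).next 3 = 4`. [folklore] -/
theorem up_nat_next_three : (ComplexShape.up ℕ).next 3 = 4 := CochainComplex.next ℕ 3

/-- `(ComplexShape.up ℕ).prev 3 = 2`. [folklore] -/
theorem up_nat_prev_three : (ComplexShape.up ℕ).prev 3 = 2 := CochainComplex.prev_nat_succ 2

variable [LocallyCompactSpace G]

omit [IsTopologicalGroup G] in
/-- `nest₃` is continuous (currying is continuous on locally compact spaces). [folklore] -/
theorem continuous_nest₃ : Continuous (nest₃ X : C(G × G × G, X) → C(G, C(G, C(G, X)))) :=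
  (ContinuousMap.continuous_postcomp _).comp ContinuousMap.continuous_curry

omit [IsTopologicalGroup G] in
/-- A continuous function of four variables as a nested continuous map (currying three times;
`G` locally compact). [folklore] -/
def nest₄ (Φ : C(G × G × G × G, X)) : C(G, C(G, C(G, C(G, X)))) :=
  ⟨fun x ↦ nest₃ X (Φ.curry x), (continuous_nest₃ X).comp Φ.curry.continuous⟩

omit [IsTopologicalGroup G] in
/-- Unfolding `nest₄`. [folklore] -/
@[simp] theorem nest₄_apply (Φ : C(G × G × G × G, X)) (x y z w : G) :
    nest₄ X Φ x y z w = Φ (x, y, z, w) := rfl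

omit [LocallyCompactSpace G] in
/-- The differential of an invariant `2`-cochain, on elements:
`(dT)(x, y, z, w) = T(y, z, w) - (T(x, z, w) - (T(x, y, w) - T(x, y, z)))`. [folklore] -/
theorem d_two_three_apply (T : (homogeneousCochains X).X 2) (x y z w : G) :
    (((homogeneousCochains X).d 2 3 T : (homogeneousCochains X).X 3) :
        C(G, C(G, C(G, C(G, X))))) x y z w =
      (T : C(G, C(G, C(G, X)))) y z w - ((T : C(G, C(G, C(G, X)))) x z w -
        ((T : C(G, C(G, C(G, X)))) x y w - (T : C(G, C(G, C(G, X)))) x y z)) := by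
  have h := homogeneousCochains.d_apply X 2 T
  change (((homogeneousCochains X).d 2 3 T : (homogeneousCochains X).X 3) :
    C(G, C(G, C(G, C(G, X))))) = (d X 3).hom T.1 at h
  rw [h]
  rfl

/-- An invariant homogeneous `2`-cochain from a continuous function of three variables satisfying
the invariance identity. [folklore] -/
def twoCochainOfFun (H : C(G × G × G, X))
    (hH : ∀ (s x y z : G), X.ρ s (H (s⁻¹ * x, s⁻¹ * y, s⁻¹ * z)) = H (x, y, z)) :
    (homogeneousCochains X).X 2 :=
  ⟨nest₃ X H, by
    rw [ContRepresentation.mem_invariants]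
    intro s
    refine ContinuousMap.ext fun x => ContinuousMap.ext fun y => ContinuousMap.ext fun z => ?_
    rw [resolutionX_three_ρ_apply, nest₃_apply, nest₃_apply, hH]⟩

/-- Unfolding `twoCochainOfFun`. [folklore] -/
@[simp] theorem twoCochainOfFun_apply (H : C(G × G × G, X))
    (hH : ∀ (s x y z : G), X.ρ s (H (s⁻¹ * x, s⁻¹ * y, s⁻¹ * z)) = H (x, y, z)) (x y z : G) :
    ((twoCochainOfFun X H hH : (homogeneousCochains X).X 2) : C(G, C(G, C(G, X)))) x y z =
      H (x, y, z) := rfl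

end Cochains

/-! ### Continuous inhomogeneous `3`-cocycles -/

section ThreeCocycles

variable {R : Type u} [CommRing R] [TopologicalSpace R]
variable {G : Type v} [Group G] [TopologicalSpace G] [IsTopologicalGroup G]
variable (X : TopRep.{v} R G)

/-- The `R`-module of **continuous inhomogeneous `3`-cocycles** of a topological representation
`X`: continuous `f : G × G × G → X` with
`σ f(τ, υ, ω) + f(σ, τυ, ω) + f(σ, τ, υ) = f(στ, υ, ω) + f(σ, τ, υω)`, i.e.
`σ f(τ, υ, ω) - f(στ, υ, ω) + f(σ, τυ, ω) - f(σ, τ, υω) + f(σ, τ, υ) = 0`.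
Ref: Serre, *Cohomologie galoisienne*, I §2.2; Neukirch–Schmidt–Wingberg (2008), I §2.
[folklore] -/
def contThreeCocycles : Submodule R C(G × G × G, X) where
  carrier := {f | ∀ σ τ υ ω : G, X.ρ σ (f (τ, υ, ω)) + f (σ, τ * υ, ω) + f (σ, τ, υ) =
    f (σ * τ, υ, ω) + f (σ, τ, υ * ω)}
  zero_mem' σ τ υ ω := by simp
  add_mem' {a b} ha hb σ τ υ ω := by
    have ha' := ha σ τ υ ω
    have hb' := hb σ τ υ ω
    simp only [ContinuousMap.add_apply, map_add]
    calc X.ρ σ (a (τ, υ, ω)) + X.ρ σ (b (τ, υ, ω)) + (a (σ, τ * υ, ω) + b (σ, τ * υ, ω)) +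
          (a (σ, τ, υ) + b (σ, τ, υ))
        = (X.ρ σ (a (τ, υ, ω)) + a (σ, τ * υ, ω) + a (σ, τ, υ)) +
            (X.ρ σ (b (τ, υ, ω)) + b (σ, τ * υ, ω) + b (σ, τ, υ)) := by abel
      _ = (a (σ * τ, υ, ω) + a (σ, τ, υ * ω)) + (b (σ * τ, υ, ω) + b (σ, τ, υ * ω)) := by
          rw [ha', hb']
      _ = a (σ * τ, υ, ω) + b (σ * τ, υ, ω) + (a (σ, τ, υ * ω) + b (σ, τ, υ * ω)) := by abel
  smul_mem' r a ha σ τ υ ω := by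
    simp only [ContinuousMap.smul_apply, map_smul, ← smul_add, ha σ τ υ ω]

omit [IsTopologicalGroup G] in
variable {X} in
/-- Membership in `contThreeCocycles`: the `3`-cocycle identity. [folklore] -/
theorem mem_contThreeCocycles_iff (f : C(G × G × G, X)) :
    f ∈ contThreeCocycles X ↔
      ∀ σ τ υ ω : G, X.ρ σ (f (τ, υ, ω)) + f (σ, τ * υ, ω) + f (σ, τ, υ) =
        f (σ * τ, υ, ω) + f (σ, τ, υ * ω) :=
  Iff.rfl

namespace contThreeCocycles

omit [IsTopologicalGroup G] in
variable {X} in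
/-- The `3`-cocycle identity solved for `σ f(τ, υ, ω)`. [folklore] -/
theorem smul_apply (f : contThreeCocycles X) (σ τ υ ω : G) :
    X.ρ σ (f.1 (τ, υ, ω)) =
      f.1 (σ * τ, υ, ω) + f.1 (σ, τ, υ * ω) - f.1 (σ, τ * υ, ω) - f.1 (σ, τ, υ) := by
  have h := f.2 σ τ υ ω
  rw [← h]
  abel

omit [IsTopologicalGroup G] in
variable {X} in
/-- `f(1, τυ, ω) + f(1, τ, υ) = f(1, τ, υω)` for a `3`-cocycle `f`. [folklore] -/
theorem apply_one (f : contThreeCocycles X) (τ υ ω : G) :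
    f.1 (1, τ * υ, ω) + f.1 (1, τ, υ) = f.1 (1, τ, υ * ω) := by
  have h := f.2 1 τ υ ω
  rw [_root_.map_one, one_mul, one_apply_eq_self, add_assoc] at h
  exact add_left_cancel h

end contThreeCocycles

/-- The function
`(x, y, z, w) ↦ f(y, y⁻¹z, z⁻¹w) + f(x, x⁻¹y, y⁻¹w) - f(x, x⁻¹z, z⁻¹w) - f(x, x⁻¹y, y⁻¹z)`
attached to a continuous function of three variables, as a continuous function of four variables
(for a `3`-cocycle this is the homogeneous cochain `x f(x⁻¹y, y⁻¹z, z⁻¹w)`, see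
`toThreeCochain_apply_eq_smul`). [folklore] -/
def homogeneousFun₃ (f : C(G × G × G, X)) : C(G × G × G × G, X) where
  toFun p := f (p.2.1, p.2.1⁻¹ * p.2.2.1, p.2.2.1⁻¹ * p.2.2.2) +
      f (p.1, p.1⁻¹ * p.2.1, p.2.1⁻¹ * p.2.2.2) -
    f (p.1, p.1⁻¹ * p.2.2.1, p.2.2.1⁻¹ * p.2.2.2) - f (p.1, p.1⁻¹ * p.2.1, p.2.1⁻¹ * p.2.2.1)
  continuous_toFun := by fun_prop

/-- Unfolding `homogeneousFun₃`. [folklore] -/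
@[simp] theorem homogeneousFun₃_apply (f : C(G × G × G, X)) (x y z w : G) :
    homogeneousFun₃ X f (x, y, z, w) =
      f (y, y⁻¹ * z, z⁻¹ * w) + f (x, x⁻¹ * y, y⁻¹ * w) - f (x, x⁻¹ * z, z⁻¹ * w) -
        f (x, x⁻¹ * y, y⁻¹ * z) := rfl

variable [LocallyCompactSpace G]

/-- **The invariant homogeneous `3`-cochain of a continuous inhomogeneous `3`-cocycle**
(`= x f(x⁻¹y, y⁻¹z, z⁻¹w)`, `toThreeCochain_apply_eq_smul`); it is `G`-invariant.
Ref: Serre, *Galois Cohomology*, I §2.2. [folklore] -/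
def toThreeCochain (f : contThreeCocycles X) : (homogeneousCochains X).X 3 :=
  ⟨nest₄ X (homogeneousFun₃ X f.1), by
    rw [ContRepresentation.mem_invariants]
    intro s
    refine ContinuousMap.ext fun x => ContinuousMap.ext fun y => ContinuousMap.ext fun z =>
      ContinuousMap.ext fun w => ?_
    rw [resolutionX_four_ρ_apply, nest₄_apply, nest₄_apply, homogeneousFun₃_apply,
      homogeneousFun₃_apply]
    rw [inv_mul_inv_mul_inv_mul, inv_mul_inv_mul_inv_mul, inv_mul_inv_mul_inv_mul,
      inv_mul_inv_mul_inv_mul, inv_mul_inv_mul_inv_mul, map_sub, map_sub, map_add,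
      contThreeCocycles.smul_apply, contThreeCocycles.smul_apply, contThreeCocycles.smul_apply,
      contThreeCocycles.smul_apply]
    simp only [mul_inv_cancel_left, inv_mul_mul_inv_mul]
    abel⟩

/-- Unfolding `toThreeCochain` on elements. [folklore] -/
@[simp] theorem toThreeCochain_apply (f : contThreeCocycles X) (x y z w : G) :
    ((toThreeCochain X f : (homogeneousCochains X).X 3) : C(G, C(G, C(G, C(G, X))))) x y z w =
      f.1 (y, y⁻¹ * z, z⁻¹ * w) + f.1 (x, x⁻¹ * y, y⁻¹ * w) - f.1 (x, x⁻¹ * z, z⁻¹ * w) -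
        f.1 (x, x⁻¹ * y, y⁻¹ * z) := rfl

/-- The homogeneous cochain of `f` is `(x, y, z, w) ↦ x f(x⁻¹y, y⁻¹z, z⁻¹w)` (the classical
dictionary between inhomogeneous and homogeneous cochains).
[cite: SerreGaloisCohomology1997, I §2.2] -/
theorem toThreeCochain_apply_eq_smul (f : contThreeCocycles X) (x y z w : G) :
    ((toThreeCochain X f : (homogeneousCochains X).X 3) : C(G, C(G, C(G, C(G, X))))) x y z w =
      X.ρ x (f.1 (x⁻¹ * y, y⁻¹ * z, z⁻¹ * w)) := by
  rw [toThreeCochain_apply, contThreeCocycles.smul_apply, mul_inv_cancel_left, inv_mul_mul_inv_mul,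
    inv_mul_mul_inv_mul]

/-- Additivity of `toThreeCochain`. [folklore] -/
theorem toThreeCochain_add (f g : contThreeCocycles X) :
    toThreeCochain X (f + g) = toThreeCochain X f + toThreeCochain X g := by
  refine Subtype.ext (ContinuousMap.ext fun x => ContinuousMap.ext fun y =>
    ContinuousMap.ext fun z => ContinuousMap.ext fun w => ?_)
  change homogeneousFun₃ X (f.1 + g.1) (x, y, z, w) =
    homogeneousFun₃ X f.1 (x, y, z, w) + homogeneousFun₃ X g.1 (x, y, z, w)
  simp only [homogeneousFun₃_apply, ContinuousMap.add_apply]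
  abel

/-- Linearity of `toThreeCochain`. [folklore] -/
theorem toThreeCochain_smul (r : R) (f : contThreeCocycles X) :
    toThreeCochain X (r • f) = r • toThreeCochain X f := by
  refine Subtype.ext (ContinuousMap.ext fun x => ContinuousMap.ext fun y =>
    ContinuousMap.ext fun z => ContinuousMap.ext fun w => ?_)
  change homogeneousFun₃ X (r • f.1) (x, y, z, w) = r • homogeneousFun₃ X f.1 (x, y, z, w)
  simp only [homogeneousFun₃_apply, ContinuousMap.smul_apply, smul_sub, smul_add]

/-- **`d F = 0`** for the homogeneous cochain of an inhomogeneous `3`-cocycle (a formal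
cancellation: `F` is formally the boundary of `(a, b, c) ↦ f(a, a⁻¹b, b⁻¹c)`). [folklore] -/
theorem d_toThreeCochain (f : contThreeCocycles X) :
    (homogeneousCochains X).d 3 4 (toThreeCochain X f) = 0 := by
  apply Subtype.ext
  have h := homogeneousCochains.d_apply X 3 (toThreeCochain X f)
  change ((homogeneousCochains X).d 3 4 (toThreeCochain X f)).1 =
    (d X 4).hom (nest₄ X (homogeneousFun₃ X f.1)) at h
  rw [h]
  ext x y z w t
  rw [d_four_hom_apply, nest₄_apply, nest₄_apply, nest₄_apply, nest₄_apply, nest₄_apply,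
    homogeneousFun₃_apply, homogeneousFun₃_apply, homogeneousFun₃_apply, homogeneousFun₃_apply,
    homogeneousFun₃_apply]
  change _ = (0 : X)
  abel

/-- The class **`[f] ∈ H³_cont(G, X)`** of a continuous inhomogeneous `3`-cocycle.
Ref: Serre, *Galois Cohomology*, I §2.2. [folklore] -/
def threeCocycleClass (f : contThreeCocycles X) : continuousCohomology 3 X :=
  cxClass (homogeneousCochains X) 3 4 up_nat_next_three (toThreeCochain X f) (d_toThreeCochain X f)

/-- Additivity of `threeCocycleClass`. [folklore] -/
theorem threeCocycleClass_add (f g : contThreeCocycles X) :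
    threeCocycleClass X (f + g) = threeCocycleClass X f + threeCocycleClass X g := by
  unfold threeCocycleClass
  rw [← cxClass_add]
  exact cxClass_congr (toThreeCochain_add X f g)

/-- Linearity of `threeCocycleClass`. [folklore] -/
theorem threeCocycleClass_smul (r : R) (f : contThreeCocycles X) :
    threeCocycleClass X (r • f) = r • threeCocycleClass X f := by
  unfold threeCocycleClass
  rw [← cxClass_smul]
  exact cxClass_congr (toThreeCochain_smul X r f)

/-- The class map `Z³_cont(G, X) → H³_cont(G, X)` as an `R`-linear map. [folklore] -/
def threeCocycleClassₗ : contThreeCocycles X →ₗ[R] continuousCohomology 3 X where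
  toFun := threeCocycleClass X
  map_add' := threeCocycleClass_add X
  map_smul' := threeCocycleClass_smul X

/-- Unfolding `threeCocycleClassₗ`. [folklore] -/
@[simp] theorem threeCocycleClassₗ_apply (f : contThreeCocycles X) :
    threeCocycleClassₗ X f = threeCocycleClass X f := rfl

/-- The zero cocycle has zero class. [folklore] -/
theorem threeCocycleClass_zero : threeCocycleClass X 0 = 0 := (threeCocycleClassₗ X).map_zero

/-- `threeCocycleClass` respects subtraction. [folklore] -/
theorem threeCocycleClass_sub (f g : contThreeCocycles X) :
    threeCocycleClass X (f - g) = threeCocycleClass X f - threeCocycleClass X g :=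
  (threeCocycleClassₗ X).map_sub f g

/-- `threeCocycleClass` respects negation. [folklore] -/
theorem threeCocycleClass_neg (f : contThreeCocycles X) :
    threeCocycleClass X (-f) = -threeCocycleClass X f :=
  (threeCocycleClassₗ X).map_neg f

/-- The inhomogeneous cochain `(σ, τ, υ) ↦ F(1, σ, στ, στυ)` of a homogeneous `3`-cochain `F`, as a
continuous map (evaluation is jointly continuous, `G` being locally compact). [folklore] -/
def inhomogeneousFun₃ (F : C(G, C(G, C(G, C(G, X))))) : C(G × G × G, X) :=
  (((F 1).uncurry).uncurry).comp
    ⟨fun p : G × G × G => ((p.1, p.1 * p.2.1), p.1 * p.2.1 * p.2.2), by fun_prop⟩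

omit [IsTopologicalGroup G] in
/-- Unfolding `inhomogeneousFun₃`. [folklore] -/
@[simp] theorem inhomogeneousFun₃_apply [IsTopologicalGroup G] (F : C(G, C(G, C(G, C(G, X)))))
    (σ τ υ : G) : inhomogeneousFun₃ X F (σ, τ, υ) = F 1 σ (σ * τ) (σ * τ * υ) := rfl

/-- **Every class in `H³_cont(G, X)` is the class of a continuous inhomogeneous `3`-cocycle**
(namely of `f(σ, τ, υ) = F(1, σ, στ, στυ)` for an invariant homogeneous cocycle `F` representing
it). Ref: Serre, *Cohomologie galoisienne*, I §2.2–2.3. [cite: SerreGaloisCohomology1997, I §2.2] -/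
theorem threeCocycleClass_surjective : Function.Surjective (threeCocycleClass X) := by
  intro γ
  obtain ⟨F, hF, rfl⟩ := cxClass_surjective (homogeneousCochains X) 3 4 up_nat_next_three γ
  -- the cocycle identity of `F`
  have hcoc : ∀ x y z w t, F.1 y z w t - (F.1 x z w t - (F.1 x y w t - (F.1 x y z t - F.1 x y z w))) = 0 := by
    intro x y z w t
    have h := homogeneousCochains.d_apply X 3 F
    change ((homogeneousCochains X).d 3 4 F).1 = (d X 4).hom F.1 at h
    rw [hF] at h
    have h' := congrArg (fun Φ : C(G, C(G, C(G, C(G, C(G, X))))) => Φ x y z w t) h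
    exact h'.symm
  -- invariance of `F`
  have hinv : ∀ g x y z w, X.ρ g (F.1 (g⁻¹ * x) (g⁻¹ * y) (g⁻¹ * z) (g⁻¹ * w)) = F.1 x y z w :=
    fun g x y z w => congrArg (fun Φ : C(G, C(G, C(G, C(G, X)))) => Φ x y z w) (F.2 g)
  have hf : inhomogeneousFun₃ X F.1 ∈ contThreeCocycles X := by
    intro σ τ υ ω
    simp only [inhomogeneousFun₃_apply, mul_assoc]
    have h1 := hinv σ σ (σ * τ) (σ * (τ * υ)) (σ * (τ * (υ * ω)))
    rw [inv_mul_cancel, inv_mul_cancel_left, inv_mul_cancel_left, inv_mul_cancel_left] at h1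
    have h2 := hcoc 1 σ (σ * τ) (σ * (τ * υ)) (σ * (τ * (υ * ω)))
    rw [← h1] at h2
    rw [← sub_eq_zero, ← h2]
    abel
  refine ⟨⟨inhomogeneousFun₃ X F.1, hf⟩, cxClass_congr (Subtype.ext ?_)⟩
  refine ContinuousMap.ext fun x => ContinuousMap.ext fun y => ContinuousMap.ext fun z =>
    ContinuousMap.ext fun w => ?_
  rw [toThreeCochain_apply]
  simp only [inhomogeneousFun₃_apply, mul_inv_cancel_left]
  have h := hcoc 1 x y z w
  rw [sub_eq_zero] at h
  rw [h]
  abel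

/-- **A continuous `3`-cocycle has trivial class iff it is the coboundary of a continuous
`2`-cochain**: `[f] = 0 ↔ ∃ b : C(G × G, X), f(σ, τ, υ) = σ b(τ, υ) - b(στ, υ) + b(σ, τυ) - b(σ, τ)`.
Ref: Serre, *Cohomologie galoisienne*, I §2.2–2.3; Neukirch–Schmidt–Wingberg (2008), I §2.
[cite: SerreGaloisCohomology1997, I §2.2] -/
theorem threeCocycleClass_eq_zero_iff (f : contThreeCocycles X) :
    threeCocycleClass X f = 0 ↔
      ∃ b : C(G × G, X), ∀ σ τ υ : G,
        f.1 (σ, τ, υ) = X.ρ σ (b (τ, υ)) - b (σ * τ, υ) + b (σ, τ * υ) - b (σ, τ) := by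
  unfold threeCocycleClass
  rw [cxClass_eq_zero_iff _ 3 4 up_nat_next_three 2 up_nat_prev_three]
  constructor
  · rintro ⟨T, hT⟩
    refine ⟨((T.1 : C(G, C(G, C(G, X)))) 1).uncurry.comp
      ⟨fun p : G × G => (p.1, p.1 * p.2), by fun_prop⟩, fun σ τ υ => ?_⟩
    have h1 := congrArg (fun s : (homogeneousCochains X).X 3 =>
      (s.1 : C(G, C(G, C(G, C(G, X))))) 1 σ (σ * τ) (σ * τ * υ)) hT
    simp only at h1
    rw [d_two_three_apply, toThreeCochain_apply, inv_mul_cancel_left, inv_mul_cancel_left, inv_one,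
      one_mul, one_mul, mul_assoc σ τ υ, inv_mul_cancel_left] at h1
    -- `T σ (στ) (στυ) = σ T(1, τ, τυ)` by invariance
    have h2 : (T.1 : C(G, C(G, C(G, X)))) σ (σ * τ) (σ * (τ * υ)) =
        X.ρ σ ((T.1 : C(G, C(G, C(G, X)))) 1 τ (τ * υ)) := by
      have h := congrArg (fun Φ : C(G, C(G, C(G, X))) => Φ σ (σ * τ) (σ * (τ * υ))) (T.2 σ)
      simp only at h
      rw [← h, resolutionX_three_ρ_apply, inv_mul_cancel, inv_mul_cancel_left, inv_mul_cancel_left]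
    -- normalisation of `f` on `1`
    have e4 : f.1 (1, σ, τ * υ) = f.1 (1, σ * τ, υ) + f.1 (1, σ, τ) :=
      (contThreeCocycles.apply_one f σ τ υ).symm
    rw [h2, e4] at h1
    simp only [ContinuousMap.comp_apply, ContinuousMap.coe_mk, ContinuousMap.uncurry_apply]
    rw [mul_assoc σ τ υ]
    have h5 : f.1 (σ, τ, υ) = X.ρ σ ((T.1 : C(G, C(G, C(G, X)))) 1 τ (τ * υ)) -
        ((T.1 : C(G, C(G, C(G, X)))) 1 (σ * τ) (σ * (τ * υ)) -
          ((T.1 : C(G, C(G, C(G, X)))) 1 σ (σ * (τ * υ)) - (T.1 : C(G, C(G, C(G, X)))) 1 σ (σ * τ))) := by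
      rw [h1]; abel
    rw [h5]
    abel
  · rintro ⟨b, hb⟩
    let H : C(G × G × G, X) :=
      ⟨fun p => f.1 (p.1, p.1⁻¹ * p.2.1, p.2.1⁻¹ * p.2.2) + b (p.2.1, p.2.1⁻¹ * p.2.2) -
        b (p.1, p.1⁻¹ * p.2.2) + b (p.1, p.1⁻¹ * p.2.1), by fun_prop⟩
    have hH : ∀ x y z, H (x, y, z) = f.1 (x, x⁻¹ * y, y⁻¹ * z) + b (y, y⁻¹ * z) -
        b (x, x⁻¹ * z) + b (x, x⁻¹ * y) := fun _ _ _ => rfl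
    have hH' : ∀ x y z, H (x, y, z) = X.ρ x (b (x⁻¹ * y, y⁻¹ * z)) := fun x y z => by
      rw [hH, hb, mul_inv_cancel_left, inv_mul_mul_inv_mul]
      abel
    have hHinv : ∀ (s x y z : G), X.ρ s (H (s⁻¹ * x, s⁻¹ * y, s⁻¹ * z)) = H (x, y, z) := by
      intro s x y z
      rw [hH', hH', inv_mul_inv_mul_inv_mul, inv_mul_inv_mul_inv_mul,
        ← ContinuousLinearMap.comp_apply, ← ContinuousLinearMap.mul_def, ← map_mul,
        mul_inv_cancel_left]
    refine ⟨twoCochainOfFun X H hHinv, Subtype.ext ?_⟩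
    refine ContinuousMap.ext fun x => ContinuousMap.ext fun y => ContinuousMap.ext fun z =>
      ContinuousMap.ext fun w => ?_
    rw [d_two_three_apply, twoCochainOfFun_apply, twoCochainOfFun_apply, twoCochainOfFun_apply,
      twoCochainOfFun_apply, toThreeCochain_apply, hH, hH, hH, hH]
    abel

/-! ### Functoriality -/

variable {H : Type v} [Group H] [TopologicalSpace H] [IsTopologicalGroup H] [LocallyCompactSpace H]
  {Y : TopRep.{v} R H}

omit [LocallyCompactSpace G] in
variable {X} in
/-- Pulling back a continuous `3`-cocycle along a compatible pair `(θ : H → G, φ : X → Y)`: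
`(σ, τ, υ) ↦ φ (f (θ σ, θ τ, θ υ))`. Ref: Serre, *Galois Cohomology*, I §2.4. [folklore] -/
def contThreeCocycles.pullback (θ : H →ₜ* G) (φ : res (θ : H →* G) X ⟶ Y)
    (f : contThreeCocycles X) : contThreeCocycles Y :=
  ⟨(φ.hom : C(X, Y)).comp (f.1.comp ((θ : C(H, G)).prodMap ((θ : C(H, G)).prodMap (θ : C(H, G))))),
    fun σ τ υ ω => by
    change Y.ρ σ (φ.hom (f.1 (θ τ, θ υ, θ ω))) + φ.hom (f.1 (θ σ, θ (τ * υ), θ ω)) +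
        φ.hom (f.1 (θ σ, θ τ, θ υ)) =
      φ.hom (f.1 (θ (σ * τ), θ υ, θ ω)) + φ.hom (f.1 (θ σ, θ τ, θ (υ * ω)))
    rw [map_mul, map_mul, map_mul, ← TopRep.hom_comm_apply φ σ, ← map_add, ← map_add, ← map_add]
    exact congrArg φ.hom (f.2 (θ σ) (θ τ) (θ υ) (θ ω))⟩

omit [IsTopologicalGroup G] [IsTopologicalGroup H] [LocallyCompactSpace G]
  [LocallyCompactSpace H] in
/-- Unfolding `contThreeCocycles.pullback`. [folklore] -/
@[simp] theorem contThreeCocycles.pullback_apply (θ : H →ₜ* G) (φ : res (θ : H →* G) X ⟶ Y)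
    (f : contThreeCocycles X) (σ τ υ : H) :
    (contThreeCocycles.pullback θ φ f).1 (σ, τ, υ) = φ.hom (f.1 (θ σ, θ τ, θ υ)) := rfl

/-- **Functoriality of `H³` on explicit cocycles**: Mathlib's `ContinuousCohomology.map θ φ 3`
sends `[f]` to `[φ ∘ f ∘ (θ × θ × θ)]`. Ref: Serre, *Galois Cohomology*, I §2.4.
[cite: SerreGaloisCohomology1997, I §2.4] -/
theorem map_threeCocycleClass (θ : H →ₜ* G) (φ : res (θ : H →* G) X ⟶ Y)
    (f : contThreeCocycles X) :
    ContinuousCohomology.map θ φ 3 (threeCocycleClass X f) =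
      threeCocycleClass Y (contThreeCocycles.pullback θ φ f) := by
  unfold threeCocycleClass ContinuousCohomology.map
  refine homologyMap_cxClass _ 3 4 up_nat_next_three _ _ _ _ (Subtype.ext ?_)
  refine ContinuousMap.ext fun x => ContinuousMap.ext fun y => ContinuousMap.ext fun z =>
    ContinuousMap.ext fun w => ?_
  change (contThreeCocycles.pullback θ φ f).1 (y, y⁻¹ * z, z⁻¹ * w) +
        (contThreeCocycles.pullback θ φ f).1 (x, x⁻¹ * y, y⁻¹ * w) -
        (contThreeCocycles.pullback θ φ f).1 (x, x⁻¹ * z, z⁻¹ * w) -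
        (contThreeCocycles.pullback θ φ f).1 (x, x⁻¹ * y, y⁻¹ * z) =
    φ.hom (f.1 (θ y, (θ y)⁻¹ * θ z, (θ z)⁻¹ * θ w) + f.1 (θ x, (θ x)⁻¹ * θ y, (θ y)⁻¹ * θ w) -
      f.1 (θ x, (θ x)⁻¹ * θ z, (θ z)⁻¹ * θ w) - f.1 (θ x, (θ x)⁻¹ * θ y, (θ y)⁻¹ * θ z))
  simp only [contThreeCocycles.pullback_apply, map_mul, map_inv, map_sub, map_add]

end ThreeCocycles

/-! ### Cup products into degree three on inhomogeneous cocycles -/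

section CupHelpers

variable {R : Type u} [CommRing R] [TopologicalSpace R]
variable {G : Type v} [Group G] [TopologicalSpace G]
variable {Y : TopRep.{v} R G}

/-- `g(ab) - g(a) = a · g(b)` for a crossed homomorphism `g`. [folklore] -/
theorem contOneCocycles.apply_mul_sub (g : contOneCocycles Y) (a b : G) :
    g.1 (a * b) - g.1 a = Y.ρ a (g.1 b) := by
  rw [g.2 a b]
  abel

omit [TopologicalSpace G] in
/-- `ρ(a) (ρ(b) y) = ρ(ab) y`. [folklore] -/
theorem TopRep_ρ_mul_apply (a b : G) (y : Y) : Y.ρ a (Y.ρ b y) = Y.ρ (a * b) y := by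
  rw [← ContinuousLinearMap.comp_apply, ← ContinuousLinearMap.mul_def, ← map_mul]

end CupHelpers

namespace ContPairing

variable {R : Type u} [CommRing R] [TopologicalSpace R]
variable {G : Type v} [Group G] [TopologicalSpace G] [IsTopologicalGroup G] [LocallyCompactSpace G]
variable {X Y Z : TopRep.{v} R G} (φ : ContPairing X Y Z)

omit [TopologicalSpace G] [IsTopologicalGroup G] [LocallyCompactSpace G] in
/-- Continuity of `p ↦ ⟨a p, b p⟩` for continuous `a`, `b`. [folklore] -/
theorem continuous_toLin_comp {α : Type*} [TopologicalSpace α] {a : α → X} {b : α → Y}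
    (ha : Continuous a) (hb : Continuous b) : Continuous fun p ↦ φ.toLin (a p) (b p) :=
  φ.continuous_toLin.comp (ha.prodMk hb)

omit [LocallyCompactSpace G] in
/-- **The cup product `Z² × Z¹ → Z³` on inhomogeneous cocycles**:
`(f ∪ g)(σ, τ, υ) = ⟨f(σ, τ), στ g(υ)⟩ = ⟨f(σ, τ), g(στυ) - g(στ)⟩`.
Ref: Neukirch–Schmidt–Wingberg, *Cohomology of Number Fields* (2008), I §4,
`(a ∪ b)(σ₁, …, σ_{p+q}) = a(σ₁, …, σ_p) ⊗ σ₁⋯σ_p b(σ_{p+1}, …, σ_{p+q})`; Milne, *ADT*, I §0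
("Cup products" on inhomogeneous cochains). [cite: NeukirchSchmidtWingberg2008, I §4] -/
def cupCocycle₂₁ (f : contTwoCocycles X) (g : contOneCocycles Y) : contThreeCocycles Z :=
  ⟨⟨fun p => φ.toLin (f.1 (p.1, p.2.1)) (g.1 (p.1 * p.2.1 * p.2.2) - g.1 (p.1 * p.2.1)),
      φ.continuous_toLin_comp (f.1.continuous.comp (continuous_fst.prodMk
        (continuous_fst.comp continuous_snd)))
        ((g.1.continuous.comp ((continuous_fst.mul (continuous_fst.comp continuous_snd)).mul
          (continuous_snd.comp continuous_snd))).sub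
          (g.1.continuous.comp (continuous_fst.mul (continuous_fst.comp continuous_snd))))⟩,
    fun σ τ υ ω => by
    change Z.ρ σ (φ.toLin (f.1 (τ, υ)) (g.1 (τ * υ * ω) - g.1 (τ * υ))) +
          φ.toLin (f.1 (σ, τ * υ)) (g.1 (σ * (τ * υ) * ω) - g.1 (σ * (τ * υ))) +
          φ.toLin (f.1 (σ, τ)) (g.1 (σ * τ * υ) - g.1 (σ * τ)) =
        φ.toLin (f.1 (σ * τ, υ)) (g.1 (σ * τ * υ * ω) - g.1 (σ * τ * υ)) +
          φ.toLin (f.1 (σ, τ)) (g.1 (σ * τ * (υ * ω)) - g.1 (σ * τ))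
    rw [contOneCocycles.apply_mul_sub, contOneCocycles.apply_mul_sub,
      contOneCocycles.apply_mul_sub, contOneCocycles.apply_mul_sub,
      contOneCocycles.apply_mul_sub, ← φ.toLin_smul, contTwoCocycles.smul_apply,
      TopRep_ρ_mul_apply, g.2 υ ω, ← mul_assoc σ τ υ]
    simp only [map_add, map_sub, LinearMap.add_apply, LinearMap.sub_apply, TopRep_ρ_mul_apply]
    abel⟩

omit [LocallyCompactSpace G] in
/-- Unfolding `cupCocycle₂₁`. [folklore] -/
@[simp] theorem cupCocycle₂₁_apply (f : contTwoCocycles X) (g : contOneCocycles Y) (σ τ υ : G) :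
    (φ.cupCocycle₂₁ f g).1 (σ, τ, υ) = φ.toLin (f.1 (σ, τ)) (g.1 (σ * τ * υ) - g.1 (σ * τ)) := rfl

omit [LocallyCompactSpace G] in
/-- `(f ∪ g)(σ, τ, υ) = ⟨f(σ, τ), στ g(υ)⟩`. [folklore] -/
theorem cupCocycle₂₁_apply_eq_smul (f : contTwoCocycles X) (g : contOneCocycles Y) (σ τ υ : G) :
    (φ.cupCocycle₂₁ f g).1 (σ, τ, υ) = φ.toLin (f.1 (σ, τ)) (Y.ρ (σ * τ) (g.1 υ)) := by
  rw [cupCocycle₂₁_apply, contOneCocycles.apply_mul_sub]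

omit [LocallyCompactSpace G] in
/-- **The cup product `Z¹ × Z² → Z³` on inhomogeneous cocycles**:
`(f ∪ g)(σ, τ, υ) = ⟨f(σ), σ g(τ, υ)⟩ = ⟨f(σ), g(στ, υ) + g(σ, τ) - g(σ, τυ)⟩`.
Ref: Neukirch–Schmidt–Wingberg (2008), I §4. [cite: NeukirchSchmidtWingberg2008, I §4] -/
def cupCocycle₁₂ (f : contOneCocycles X) (g : contTwoCocycles Y) : contThreeCocycles Z :=
  ⟨⟨fun p => φ.toLin (f.1 p.1) (g.1 (p.1 * p.2.1, p.2.2) + g.1 (p.1, p.2.1) - g.1 (p.1, p.2.1 * p.2.2)),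
      φ.continuous_toLin_comp (f.1.continuous.comp continuous_fst)
        (((g.1.continuous.comp ((continuous_fst.mul (continuous_fst.comp continuous_snd)).prodMk
          (continuous_snd.comp continuous_snd))).add
          (g.1.continuous.comp (continuous_fst.prodMk (continuous_fst.comp continuous_snd)))).sub
          (g.1.continuous.comp (continuous_fst.prodMk ((continuous_fst.comp continuous_snd).mul
            (continuous_snd.comp continuous_snd)))))⟩,
    fun σ τ υ ω => by
    have e : ∀ a b c : G, g.1 (a * b, c) + g.1 (a, b) - g.1 (a, b * c) = Y.ρ a (g.1 (b, c)) :=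
      fun a b c => (contTwoCocycles.smul_apply g a b c).symm
    change Z.ρ σ (φ.toLin (f.1 τ) (g.1 (τ * υ, ω) + g.1 (τ, υ) - g.1 (τ, υ * ω))) +
          φ.toLin (f.1 σ) (g.1 (σ * (τ * υ), ω) + g.1 (σ, τ * υ) - g.1 (σ, τ * υ * ω)) +
          φ.toLin (f.1 σ) (g.1 (σ * τ, υ) + g.1 (σ, τ) - g.1 (σ, τ * υ)) =
        φ.toLin (f.1 (σ * τ)) (g.1 (σ * τ * υ, ω) + g.1 (σ * τ, υ) - g.1 (σ * τ, υ * ω)) +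
          φ.toLin (f.1 σ) (g.1 (σ * τ, υ * ω) + g.1 (σ, τ) - g.1 (σ, τ * (υ * ω)))
    rw [e, e, e, e, e, ← φ.toLin_smul, TopRep_ρ_mul_apply, f.2 σ τ,
      contTwoCocycles.smul_apply g (σ * τ) υ ω, contTwoCocycles.smul_apply g σ (τ * υ) ω,
      contTwoCocycles.smul_apply g σ τ υ, contTwoCocycles.smul_apply g σ τ (υ * ω)]
    simp only [map_add, map_sub, LinearMap.add_apply, mul_assoc]
    abel⟩

omit [LocallyCompactSpace G] in
/-- Unfolding `cupCocycle₁₂`. [folklore] -/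
@[simp] theorem cupCocycle₁₂_apply (f : contOneCocycles X) (g : contTwoCocycles Y) (σ τ υ : G) :
    (φ.cupCocycle₁₂ f g).1 (σ, τ, υ) =
      φ.toLin (f.1 σ) (g.1 (σ * τ, υ) + g.1 (σ, τ) - g.1 (σ, τ * υ)) := rfl

omit [LocallyCompactSpace G] in
/-- `(f ∪ g)(σ, τ, υ) = ⟨f(σ), σ g(τ, υ)⟩`. [folklore] -/
theorem cupCocycle₁₂_apply_eq_smul (f : contOneCocycles X) (g : contTwoCocycles Y) (σ τ υ : G) :
    (φ.cupCocycle₁₂ f g).1 (σ, τ, υ) = φ.toLin (f.1 σ) (Y.ρ σ (g.1 (τ, υ))) := by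
  rw [cupCocycle₁₂_apply, contTwoCocycles.smul_apply]

/-- **`f ∪ g` is a coboundary when `f` is**: if `f(σ, τ) = σ c(τ) - c(στ) + c(σ)` for a
continuous `1`-cochain `c`, then `f ∪ g = ∂(c ∪ g)` with `(c ∪ g)(σ, τ) = ⟨c(σ), σ g(τ)⟩`, so
`[f ∪ g] = 0` in `H³` (the cup product `H² × H¹ → H³` is well defined in the first variable).
[folklore] -/
theorem threeCocycleClass_cupCocycle₂₁_eq_zero_of_left (f : contTwoCocycles X) (g : contOneCocycles Y)
    (hf : ∃ c : C(G, X), ∀ σ τ : G, f.1 (σ, τ) = X.ρ σ (c τ) - c (σ * τ) + c σ) :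
    threeCocycleClass Z (φ.cupCocycle₂₁ f g) = 0 := by
  obtain ⟨c, hc⟩ := hf
  rw [threeCocycleClass_eq_zero_iff]
  refine ⟨⟨fun p => φ.toLin (c p.1) (g.1 (p.1 * p.2) - g.1 p.1),
    φ.continuous_toLin_comp (c.continuous.comp continuous_fst)
      ((g.1.continuous.comp (continuous_fst.mul continuous_snd)).sub
        (g.1.continuous.comp continuous_fst))⟩, fun σ τ υ => ?_⟩
  simp only [ContinuousMap.coe_mk, cupCocycle₂₁_apply]
  rw [contOneCocycles.apply_mul_sub, contOneCocycles.apply_mul_sub,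
    contOneCocycles.apply_mul_sub, contOneCocycles.apply_mul_sub, hc, ← φ.toLin_smul,
    TopRep_ρ_mul_apply, g.2 τ υ]
  simp only [map_add, map_sub, LinearMap.add_apply, LinearMap.sub_apply, TopRep_ρ_mul_apply]
  abel

/-- **`f ∪ g` is a coboundary when `g` is principal**: if `g(τ) = τ v - v` then
`f ∪ g = ∂b` with `b(σ, τ) = ⟨f(σ, τ), στ v⟩ = ⟨f(σ, τ), g(στ) + v⟩`, so `[f ∪ g] = 0` in `H³`
(well-definedness in the second variable). [folklore] -/
theorem threeCocycleClass_cupCocycle₂₁_eq_zero_of_right (f : contTwoCocycles X)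
    (g : contOneCocycles Y) (hg : ∃ v : Y, ∀ τ : G, g.1 τ = Y.ρ τ v - v) :
    threeCocycleClass Z (φ.cupCocycle₂₁ f g) = 0 := by
  obtain ⟨v, hv⟩ := hg
  rw [threeCocycleClass_eq_zero_iff]
  refine ⟨⟨fun p => φ.toLin (f.1 (p.1, p.2)) (g.1 (p.1 * p.2) + v),
    φ.continuous_toLin_comp (f.1.continuous.comp (continuous_fst.prodMk continuous_snd))
      ((g.1.continuous.comp (continuous_fst.mul continuous_snd)).add continuous_const)⟩,
    fun σ τ υ => ?_⟩
  simp only [ContinuousMap.coe_mk, cupCocycle₂₁_apply, hv, sub_add_cancel]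
  rw [← φ.toLin_smul, contTwoCocycles.smul_apply, TopRep_ρ_mul_apply, ← mul_assoc]
  simp only [map_add, map_sub, LinearMap.add_apply, LinearMap.sub_apply]
  abel

/-- **`f ∪ g` is a coboundary when `f` is principal**: if `f(σ) = σ v - v` then `f ∪ g = ∂b`
with `b(σ, τ) = ⟨v, g(σ, τ)⟩`, so `[f ∪ g] = 0` in `H³` (well-definedness of `H¹ × H² → H³` in
the first variable). [folklore] -/
theorem threeCocycleClass_cupCocycle₁₂_eq_zero_of_left (f : contOneCocycles X)
    (g : contTwoCocycles Y) (hf : ∃ v : X, ∀ σ : G, f.1 σ = X.ρ σ v - v) :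
    threeCocycleClass Z (φ.cupCocycle₁₂ f g) = 0 := by
  obtain ⟨v, hv⟩ := hf
  rw [threeCocycleClass_eq_zero_iff]
  refine ⟨⟨fun p => φ.toLin v (g.1 (p.1, p.2)),
    φ.continuous_toLin_comp continuous_const
      (g.1.continuous.comp (continuous_fst.prodMk continuous_snd))⟩, fun σ τ υ => ?_⟩
  simp only [ContinuousMap.coe_mk, cupCocycle₁₂_apply]
  rw [hv, ← φ.toLin_smul, contTwoCocycles.smul_apply]
  simp only [map_add, map_sub, LinearMap.sub_apply]
  abel

/-- **`f ∪ g` is a coboundary when `g` is**: if `g(σ, τ) = σ c(τ) - c(στ) + c(σ)` for a continuous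
`1`-cochain `c`, then `f ∪ g = ∂(-(f ∪ c))` with `(f ∪ c)(σ, τ) = ⟨f(σ), σ c(τ)⟩ =
⟨f(σ), g(σ, τ) + c(στ) - c(σ)⟩`, so `[f ∪ g] = 0` in `H³` (well-definedness of `H¹ × H² → H³` in
the second variable). [folklore] -/
theorem threeCocycleClass_cupCocycle₁₂_eq_zero_of_right (f : contOneCocycles X)
    (g : contTwoCocycles Y) (hg : ∃ c : C(G, Y), ∀ σ τ : G, g.1 (σ, τ) = Y.ρ σ (c τ) - c (σ * τ) + c σ) :
    threeCocycleClass Z (φ.cupCocycle₁₂ f g) = 0 := by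
  obtain ⟨c, hc⟩ := hg
  rw [threeCocycleClass_eq_zero_iff]
  refine ⟨⟨fun p => -φ.toLin (f.1 p.1) (g.1 (p.1, p.2) + c (p.1 * p.2) - c p.1),
    (φ.continuous_toLin_comp (f.1.continuous.comp continuous_fst)
      (((g.1.continuous.comp (continuous_fst.prodMk continuous_snd)).add
        (c.continuous.comp (continuous_fst.mul continuous_snd))).sub
        (c.continuous.comp continuous_fst))).neg⟩, fun σ τ υ => ?_⟩
  have hc' : ∀ σ τ : G, g.1 (σ, τ) + c (σ * τ) - c σ = Y.ρ σ (c τ) := fun σ τ => by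
    rw [hc]; abel
  simp only [ContinuousMap.coe_mk, cupCocycle₁₂_apply_eq_smul, hc']
  rw [hc, f.2 σ τ, map_neg, ← φ.toLin_smul, TopRep_ρ_mul_apply]
  simp only [map_add, map_sub, LinearMap.add_apply, TopRep_ρ_mul_apply]
  abel

end ContPairing

/-! ### Coboundaries of `2`-cochains, the Leibniz rule `d(α ∪ g) = dα ∪ g`, and `2`-cocycles
with prescribed coboundary difference -/

section DTwo

variable {R : Type u} [CommRing R] [TopologicalSpace R]
variable {G : Type v} [Group G] [TopologicalSpace G] [IsTopologicalGroup G] [LocallyCompactSpace G]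
variable (X : TopRep.{v} R G)

/-- The (inhomogeneous) coboundary of a continuous `2`-cochain `b : G × G → X`, as a function:
`(db)(σ, τ, υ) = σ b(τ, υ) - b(στ, υ) + b(σ, τυ) - b(σ, τ)` (Serre, *Cohomologie galoisienne*,
I §2.2; the sign convention of `threeCocycleClass_eq_zero_iff`). [cite: SerreGaloisCohomology1997, I §2.2] -/
def dTwo (b : C(G × G, X)) (σ τ υ : G) : X :=
  X.ρ σ (b (τ, υ)) - b (σ * τ, υ) + b (σ, τ * υ) - b (σ, τ)

omit [IsTopologicalGroup G] [LocallyCompactSpace G] in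
/-- Unfolding `dTwo`. [folklore] -/
theorem dTwo_apply (b : C(G × G, X)) (σ τ υ : G) :
    dTwo X b σ τ υ = X.ρ σ (b (τ, υ)) - b (σ * τ, υ) + b (σ, τ * υ) - b (σ, τ) := rfl

omit [IsTopologicalGroup G] [LocallyCompactSpace G] in
/-- `d` is additive on `2`-cochains. [folklore] -/
theorem dTwo_add (b b' : C(G × G, X)) (σ τ υ : G) :
    dTwo X (b + b') σ τ υ = dTwo X b σ τ υ + dTwo X b' σ τ υ := by
  simp only [dTwo, ContinuousMap.add_apply, map_add]
  abel

omit [IsTopologicalGroup G] [LocallyCompactSpace G] in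
/-- `d(b - b') = db - db'`. [folklore] -/
theorem dTwo_sub (b b' : C(G × G, X)) (σ τ υ : G) :
    dTwo X (b - b') σ τ υ = dTwo X b σ τ υ - dTwo X b' σ τ υ := by
  simp only [dTwo, ContinuousMap.sub_apply, map_sub]
  abel

omit [IsTopologicalGroup G] [LocallyCompactSpace G] in
/-- `d(-b) = -db`. [folklore] -/
theorem dTwo_neg (b : C(G × G, X)) (σ τ υ : G) : dTwo X (-b) σ τ υ = -dTwo X b σ τ υ := by
  simp only [dTwo, ContinuousMap.neg_apply, map_neg]
  abel

omit [IsTopologicalGroup G] [LocallyCompactSpace G] in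
/-- `d0 = 0`. [folklore] -/
@[simp] theorem dTwo_zero (σ τ υ : G) : dTwo X (0 : C(G × G, X)) σ τ υ = 0 := by
  simp [dTwo]

omit [IsTopologicalGroup G] [LocallyCompactSpace G] in
/-- **A continuous `2`-cochain is a `2`-cocycle iff its coboundary vanishes.** [folklore] -/
theorem mem_contTwoCocycles_iff_dTwo (b : C(G × G, X)) :
    b ∈ contTwoCocycles X ↔ ∀ σ τ υ : G, dTwo X b σ τ υ = 0 := by
  rw [mem_contTwoCocycles_iff]
  refine forall₃_congr fun σ τ υ => ?_
  rw [dTwo, sub_eq_zero, sub_add_eq_add_sub, sub_eq_iff_eq_add, add_comm (b (σ, τ))]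

omit [IsTopologicalGroup G] [LocallyCompactSpace G] in
/-- The coboundary of a `2`-cocycle vanishes. [folklore] -/
@[simp] theorem dTwo_coe_contTwoCocycles (f : contTwoCocycles X) (σ τ υ : G) :
    dTwo X (f : C(G × G, X)) σ τ υ = 0 :=
  (mem_contTwoCocycles_iff_dTwo X _).1 f.2 σ τ υ

/-- `threeCocycleClass_eq_zero_iff` in terms of `dTwo`: `[f] = 0 ↔ f = db` for a continuous
`2`-cochain `b`. [cite: SerreGaloisCohomology1997, I §2.3] -/
theorem threeCocycleClass_eq_zero_iff_dTwo (f : contThreeCocycles X) :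
    threeCocycleClass X f = 0 ↔ ∃ b : C(G × G, X), ∀ σ τ υ : G, f.1 (σ, τ, υ) = dTwo X b σ τ υ :=
  threeCocycleClass_eq_zero_iff X f

variable {X}

/-- **Two continuous `2`-cochains with the same coboundary differ by a `2`-cocycle**: if
`db = dε` then `b - ε ∈ Z²`.  This is how local `2`-cocycles with prescribed "boundary behaviour"
are produced in cochain constructions through degree three (e.g. Milne, *ADT*, I Prop. 6.9:
`(β_{1,v} - β_{v,1}) ∪ β'_v - ε_v` is a `2`-cocycle because `d((β_{1,v} - β_{v,1}) ∪ β') = dε_v`).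
[folklore] -/
def contTwoCocycles.ofDTwoEq (b ε : C(G × G, X)) (h : ∀ σ τ υ : G, dTwo X b σ τ υ = dTwo X ε σ τ υ) :
    contTwoCocycles X :=
  ⟨b - ε, (mem_contTwoCocycles_iff_dTwo X _).2 fun σ τ υ => by rw [dTwo_sub, h, sub_self]⟩

omit [IsTopologicalGroup G] [LocallyCompactSpace G] in
/-- Unfolding `contTwoCocycles.ofDTwoEq`. [folklore] -/
@[simp] theorem contTwoCocycles.coe_ofDTwoEq (b ε : C(G × G, X))
    (h : ∀ σ τ υ : G, dTwo X b σ τ υ = dTwo X ε σ τ υ) :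
    ((contTwoCocycles.ofDTwoEq b ε h : contTwoCocycles X) : C(G × G, X)) = b - ε := rfl

omit [IsTopologicalGroup G] [LocallyCompactSpace G] in
/-- `ofDTwoEq b ε (σ, τ) = b(σ, τ) - ε(σ, τ)`. [folklore] -/
theorem contTwoCocycles.ofDTwoEq_apply (b ε : C(G × G, X))
    (h : ∀ σ τ υ : G, dTwo X b σ τ υ = dTwo X ε σ τ υ) (σ τ : G) :
    (contTwoCocycles.ofDTwoEq b ε h).1 (σ, τ) = b (σ, τ) - ε (σ, τ) := rfl

/-- **Changing `ε` by `ε'` with the same coboundary changes the cocycle `b - ε` by the cocycle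
`ε' - ε`**: `[b - ε] = [b - ε'] + [ε' - ε]`. [folklore] -/
theorem contTwoCocycles.twoCocycleClass_ofDTwoEq_eq_add (b ε ε' : C(G × G, X))
    (h : ∀ σ τ υ : G, dTwo X b σ τ υ = dTwo X ε σ τ υ)
    (h' : ∀ σ τ υ : G, dTwo X b σ τ υ = dTwo X ε' σ τ υ) :
    twoCocycleClass X (contTwoCocycles.ofDTwoEq b ε h) =
      twoCocycleClass X (contTwoCocycles.ofDTwoEq b ε' h') +
        twoCocycleClass X (contTwoCocycles.ofDTwoEq ε' ε fun σ τ υ => (h' σ τ υ).symm.trans (h σ τ υ)) := by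
  rw [← twoCocycleClass_add]
  congr 1
  exact Subtype.ext (by simp only [Submodule.coe_add, contTwoCocycles.coe_ofDTwoEq]; abel)

/-- **Changing `b` by `b'` with the same coboundary**: `[b - ε] = [b' - ε] + [b - b']`. [folklore] -/
theorem contTwoCocycles.twoCocycleClass_ofDTwoEq_eq_add' (b b' ε : C(G × G, X))
    (h : ∀ σ τ υ : G, dTwo X b σ τ υ = dTwo X ε σ τ υ)
    (h' : ∀ σ τ υ : G, dTwo X b' σ τ υ = dTwo X ε σ τ υ) :
    twoCocycleClass X (contTwoCocycles.ofDTwoEq b ε h) =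
      twoCocycleClass X (contTwoCocycles.ofDTwoEq b' ε h') +
        twoCocycleClass X (contTwoCocycles.ofDTwoEq b b' fun σ τ υ => (h σ τ υ).trans (h' σ τ υ).symm) := by
  rw [← twoCocycleClass_add]
  congr 1
  exact Subtype.ext (by simp only [Submodule.coe_add, contTwoCocycles.coe_ofDTwoEq]; abel)

/-- If `b` is itself a `2`-cocycle then `ofDTwoEq b ε` has class `[b] - [ε]`, `ε` being a cocycle
too. [folklore] -/
theorem contTwoCocycles.twoCocycleClass_ofDTwoEq_of_mem (b ε : C(G × G, X)) (hb : b ∈ contTwoCocycles X)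
    (h : ∀ σ τ υ : G, dTwo X b σ τ υ = dTwo X ε σ τ υ) :
    twoCocycleClass X (contTwoCocycles.ofDTwoEq b ε h) =
      twoCocycleClass X ⟨b, hb⟩ - twoCocycleClass X ⟨ε, (mem_contTwoCocycles_iff_dTwo X _).2
        fun σ τ υ => by rw [← h, (mem_contTwoCocycles_iff_dTwo X b).1 hb]⟩ := by
  rw [← twoCocycleClass_sub]
  rfl

end DTwo

namespace ContPairing

variable {R : Type u} [CommRing R] [TopologicalSpace R]
variable {G : Type v} [Group G] [TopologicalSpace G] [IsTopologicalGroup G] [LocallyCompactSpace G]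
variable {X Y Z : TopRep.{v} R G} (φ : ContPairing X Y Z)

omit [LocallyCompactSpace G] in
/-- **The cup product of a `1`-cochain with a `1`-cocycle**: for a continuous `α : G → X` and a
`1`-cocycle `g` of `Y`, the continuous `2`-cochain `(α ∪ g)(σ, τ) = ⟨α(σ), σ g(τ)⟩ =
⟨α(σ), g(στ) - g(σ)⟩` (action-free form).  Ref: Neukirch–Schmidt–Wingberg (2008), I §4 (cup
product of inhomogeneous cochains); Milne, *ADT*, I Prop. 6.9 (`(β_{1,v} - β_{v,1}) ∪ β'_v`).
[cite: NeukirchSchmidtWingberg2008, I §4] -/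
def cochainCup₁₁ (α : C(G, X)) (g : contOneCocycles Y) : C(G × G, Z) :=
  ⟨fun p => φ.toLin (α p.1) (g.1 (p.1 * p.2) - g.1 p.1),
    φ.continuous_toLin_comp (α.continuous.comp continuous_fst)
      ((g.1.continuous.comp (continuous_fst.mul continuous_snd)).sub
        (g.1.continuous.comp continuous_fst))⟩

omit [LocallyCompactSpace G] in
/-- Unfolding `cochainCup₁₁`. [folklore] -/
@[simp] theorem cochainCup₁₁_apply (α : C(G, X)) (g : contOneCocycles Y) (σ τ : G) :
    φ.cochainCup₁₁ α g (σ, τ) = φ.toLin (α σ) (g.1 (σ * τ) - g.1 σ) := rfl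

omit [LocallyCompactSpace G] in
/-- `(α ∪ g)(σ, τ) = ⟨α(σ), σ g(τ)⟩`. [folklore] -/
theorem cochainCup₁₁_apply_eq_smul (α : C(G, X)) (g : contOneCocycles Y) (σ τ : G) :
    φ.cochainCup₁₁ α g (σ, τ) = φ.toLin (α σ) (Y.ρ σ (g.1 τ)) := by
  rw [cochainCup₁₁_apply, contOneCocycles.apply_mul_sub]

omit [LocallyCompactSpace G] in
/-- `α ∪ g` is additive in `α`. [folklore] -/
theorem cochainCup₁₁_add (α α' : C(G, X)) (g : contOneCocycles Y) :
    φ.cochainCup₁₁ (α + α') g = φ.cochainCup₁₁ α g + φ.cochainCup₁₁ α' g :=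
  ContinuousMap.ext fun p => by
    obtain ⟨σ, τ⟩ := p
    simp only [ContinuousMap.add_apply, cochainCup₁₁_apply, map_add, LinearMap.add_apply]

omit [LocallyCompactSpace G] in
/-- `α ∪ g` is additive in `g`. [folklore] -/
theorem cochainCup₁₁_add_right (α : C(G, X)) (g g' : contOneCocycles Y) :
    φ.cochainCup₁₁ α (g + g') = φ.cochainCup₁₁ α g + φ.cochainCup₁₁ α g' :=
  ContinuousMap.ext fun p => by
    obtain ⟨σ, τ⟩ := p
    simp only [ContinuousMap.add_apply, cochainCup₁₁_apply, Submodule.coe_add]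
    rw [← map_add]
    congr 1
    abel

omit [LocallyCompactSpace G] in
/-- `(-α) ∪ g = -(α ∪ g)`. [folklore] -/
theorem cochainCup₁₁_neg (α : C(G, X)) (g : contOneCocycles Y) :
    φ.cochainCup₁₁ (-α) g = -φ.cochainCup₁₁ α g :=
  ContinuousMap.ext fun p => by
    obtain ⟨σ, τ⟩ := p
    simp only [ContinuousMap.neg_apply, cochainCup₁₁_apply, map_neg, LinearMap.neg_apply]

omit [LocallyCompactSpace G] in
/-- `(α - α') ∪ g = α ∪ g - α' ∪ g`. [folklore] -/
theorem cochainCup₁₁_sub (α α' : C(G, X)) (g : contOneCocycles Y) :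
    φ.cochainCup₁₁ (α - α') g = φ.cochainCup₁₁ α g - φ.cochainCup₁₁ α' g := by
  rw [sub_eq_add_neg, cochainCup₁₁_add, cochainCup₁₁_neg, ← sub_eq_add_neg]

omit [LocallyCompactSpace G] in
/-- **Leibniz rule `d(α ∪ g) = dα ∪ g`** (the `1`-cocycle `g` has `dg = 0`): if the `2`-cocycle
`f` is the coboundary of the `1`-cochain `α`, `f(σ, τ) = σ α(τ) - α(στ) + α(σ)`, then
`d(α ∪ g) = f ∪ g` pointwise.  Ref: Neukirch–Schmidt–Wingberg (2008), (1.4.1)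
`∂(a ∪ b) = ∂a ∪ b + (-1)^p a ∪ ∂b`. [cite: NeukirchSchmidtWingberg2008, Prop. 1.4.1] -/
theorem dTwo_cochainCup₁₁ (α : C(G, X)) (g : contOneCocycles Y) (f : contTwoCocycles X)
    (hf : ∀ σ τ : G, f.1 (σ, τ) = X.ρ σ (α τ) - α (σ * τ) + α σ) (σ τ υ : G) :
    dTwo Z (φ.cochainCup₁₁ α g) σ τ υ = (φ.cupCocycle₂₁ f g).1 (σ, τ, υ) := by
  simp only [dTwo, cochainCup₁₁_apply, cupCocycle₂₁_apply]
  rw [contOneCocycles.apply_mul_sub, contOneCocycles.apply_mul_sub,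
    contOneCocycles.apply_mul_sub, contOneCocycles.apply_mul_sub, hf, ← φ.toLin_smul,
    TopRep_ρ_mul_apply, g.2 τ υ]
  simp only [map_add, map_sub, LinearMap.add_apply, LinearMap.sub_apply, TopRep_ρ_mul_apply]
  abel

omit [LocallyCompactSpace G] in
/-- **`α ∪ g` is a `2`-cocycle when `α` is a `1`-cocycle**, and then it is the cup product
`cupCocycle` of `ContinuousH2.lean`. [folklore] -/
theorem cochainCup₁₁_coe_contOneCocycles (α : contOneCocycles X) (g : contOneCocycles Y) :
    φ.cochainCup₁₁ (α : C(G, X)) g = (φ.cupCocycle α g : C(G × G, Z)) :=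
  ContinuousMap.ext fun p => by
    obtain ⟨σ, τ⟩ := p
    rw [cochainCup₁₁_apply_eq_smul, ContPairing.cupCocycle_apply_eq_smul]

/-- **Milne's `2`-cocycle.** Given a `1`-cochain `α` with coboundary the `2`-cocycle `f`, a
`1`-cocycle `g` and a `2`-cochain `ε` with `dε = f ∪ g`, the `2`-cochain `α ∪ g - ε` is a
`2`-cocycle (`d(α ∪ g - ε) = f ∪ g - f ∪ g = 0`).  With `α = β_{1,v} - β_{v,1}`, `f = dβ_{1,v}`,
`g = β'_v`, `ε = ε_v` this is the local cocycle `(β_{1,v} - β_{v,1}) ∪ β'_v - ε_v` of the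
definition of the Cassels–Tate pairing (Milne, *ADT*, I Prop. 6.9, general case, with footnote 14).
[cite: MilneADT2006, Ch. I, Prop. 6.9] -/
def cupSubCocycle (α : C(G, X)) (g : contOneCocycles Y) (f : contTwoCocycles X)
    (hf : ∀ σ τ : G, f.1 (σ, τ) = X.ρ σ (α τ) - α (σ * τ) + α σ) (ε : C(G × G, Z))
    (hε : ∀ σ τ υ : G, (φ.cupCocycle₂₁ f g).1 (σ, τ, υ) = dTwo Z ε σ τ υ) : contTwoCocycles Z :=
  contTwoCocycles.ofDTwoEq (φ.cochainCup₁₁ α g) ε fun σ τ υ => by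
    rw [dTwo_cochainCup₁₁ φ α g f hf, hε]

omit [LocallyCompactSpace G] in
/-- `cupSubCocycle (σ, τ) = ⟨α(σ), σ g(τ)⟩ - ε(σ, τ)`. [folklore] -/
theorem cupSubCocycle_apply (α : C(G, X)) (g : contOneCocycles Y) (f : contTwoCocycles X)
    (hf : ∀ σ τ : G, f.1 (σ, τ) = X.ρ σ (α τ) - α (σ * τ) + α σ) (ε : C(G × G, Z))
    (hε : ∀ σ τ υ : G, (φ.cupCocycle₂₁ f g).1 (σ, τ, υ) = dTwo Z ε σ τ υ) (σ τ : G) :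
    (φ.cupSubCocycle α g f hf ε hε).1 (σ, τ) = φ.toLin (α σ) (Y.ρ σ (g.1 τ)) - ε (σ, τ) := by
  rw [cupSubCocycle, contTwoCocycles.ofDTwoEq_apply, cochainCup₁₁_apply_eq_smul]

omit [LocallyCompactSpace G] in
/-- The underlying cochain of `cupSubCocycle` is `α ∪ g - ε`. [folklore] -/
@[simp] theorem coe_cupSubCocycle (α : C(G, X)) (g : contOneCocycles Y) (f : contTwoCocycles X)
    (hf : ∀ σ τ : G, f.1 (σ, τ) = X.ρ σ (α τ) - α (σ * τ) + α σ) (ε : C(G × G, Z))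
    (hε : ∀ σ τ υ : G, (φ.cupCocycle₂₁ f g).1 (σ, τ, υ) = dTwo Z ε σ τ υ) :
    ((φ.cupSubCocycle α g f hf ε hε : contTwoCocycles Z) : C(G × G, Z)) = φ.cochainCup₁₁ α g - ε := rfl

/-- **When `α` is a `1`-cocycle and `ε` a `2`-cocycle, `[α ∪ g - ε] = [α] ∪ [g] - [ε]`** (with
`[α] ∪ [g]` the cup product `H¹ × H¹ → H²` of `ContinuousH2.lean`): the "first case" of Milne's
definition (I Prop. 6.9: `a ∈ m H¹`, where `β_{1,v} - β_{v,1}` is a cocycle `c_v` and `ε` may be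
taken to be a cocycle) is the general cochain formula. [folklore] -/
theorem twoCocycleClass_cupSubCocycle_of_mem (α : contOneCocycles X) (g : contOneCocycles Y)
    (f : contTwoCocycles X)
    (hf : ∀ σ τ : G, f.1 (σ, τ) = X.ρ σ ((α : C(G, X)) τ) - (α : C(G, X)) (σ * τ) + (α : C(G, X)) σ)
    (ε : C(G × G, Z)) (hε : ∀ σ τ υ : G, (φ.cupCocycle₂₁ f g).1 (σ, τ, υ) = dTwo Z ε σ τ υ)
    (hεZ : ε ∈ contTwoCocycles Z) :
    twoCocycleClass Z (φ.cupSubCocycle (α : C(G, X)) g f hf ε hε) =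
      φ.cupProduct (oneCocycleClass X α) (oneCocycleClass Y g) - twoCocycleClass Z ⟨ε, hεZ⟩ := by
  rw [cupProduct_oneCocycleClass_eq_twoCocycleClass, ← twoCocycleClass_sub]
  congr 1

/-! ### Change of the data in Milne's `2`-cocycle

How `cupSubCocycle α g f ε = α ∪ g - ε` changes when the cochains are changed — the cochain
identities behind "independent of the choices" and "bi-additive" in the definition of the
Cassels–Tate pairing (Milne, *ADT*, I Prop. 6.9, general case): adding a `1`-cocycle `g₀` to `α`
adds `g₀ ∪ g`; adding a `2`-cocycle `c` to `ε` subtracts `c`; the construction is additive in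
`(α, f, ε)` and in `(g, ε)`; and replacing `(α, ε)` by `(α + γ, ε + γ ∪ g)` for an arbitrary
`1`-cochain `γ` (a change of the cochain lift `β₁` by `ι ∘ γ`) does not change the cocycle at all. -/

omit [LocallyCompactSpace G] in
/-- `f ∪ g` is additive in the `2`-cocycle `f`. [folklore] -/
theorem cupCocycle₂₁_add_left (f f' : contTwoCocycles X) (g : contOneCocycles Y) :
    φ.cupCocycle₂₁ (f + f') g = φ.cupCocycle₂₁ f g + φ.cupCocycle₂₁ f' g :=
  Subtype.ext (ContinuousMap.ext fun p => by
    obtain ⟨σ, τ, υ⟩ := p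
    simp only [Submodule.coe_add, ContinuousMap.add_apply]
    change φ.toLin ((f + f').1 (σ, τ)) _ = φ.toLin (f.1 (σ, τ)) _ + φ.toLin (f'.1 (σ, τ)) _
    rw [Submodule.coe_add, ContinuousMap.add_apply, map_add, LinearMap.add_apply])

omit [LocallyCompactSpace G] in
/-- `f ∪ g` is additive in the `1`-cocycle `g`. [folklore] -/
theorem cupCocycle₂₁_add_right (f : contTwoCocycles X) (g g' : contOneCocycles Y) :
    φ.cupCocycle₂₁ f (g + g') = φ.cupCocycle₂₁ f g + φ.cupCocycle₂₁ f g' :=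
  Subtype.ext (ContinuousMap.ext fun p => by
    obtain ⟨σ, τ, υ⟩ := p
    simp only [Submodule.coe_add, ContinuousMap.add_apply]
    change φ.toLin (f.1 (σ, τ)) ((g + g').1 (σ * τ * υ) - (g + g').1 (σ * τ)) =
      φ.toLin (f.1 (σ, τ)) (g.1 (σ * τ * υ) - g.1 (σ * τ)) +
        φ.toLin (f.1 (σ, τ)) (g'.1 (σ * τ * υ) - g'.1 (σ * τ))
    rw [← map_add]
    congr 1
    simp only [Submodule.coe_add, ContinuousMap.add_apply]
    abel)

omit [LocallyCompactSpace G] in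
/-- `cupSubCocycle α g f ε` depends only on `α`, `g`, `ε` (not on the auxiliary cocycle `f` or the
proofs). [folklore] -/
theorem cupSubCocycle_congr (α : C(G, X)) (g : contOneCocycles Y) (f f' : contTwoCocycles X)
    (hf : ∀ σ τ : G, f.1 (σ, τ) = X.ρ σ (α τ) - α (σ * τ) + α σ)
    (hf' : ∀ σ τ : G, f'.1 (σ, τ) = X.ρ σ (α τ) - α (σ * τ) + α σ) (ε : C(G × G, Z))
    (hε : ∀ σ τ υ : G, (φ.cupCocycle₂₁ f g).1 (σ, τ, υ) = dTwo Z ε σ τ υ)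
    (hε' : ∀ σ τ υ : G, (φ.cupCocycle₂₁ f' g).1 (σ, τ, υ) = dTwo Z ε σ τ υ) :
    φ.cupSubCocycle α g f hf ε hε = φ.cupSubCocycle α g f' hf' ε hε' :=
  Subtype.ext rfl

omit [IsTopologicalGroup G] [LocallyCompactSpace G] in
/-- The coboundary formula `f = dα` is unchanged when a `1`-cocycle `g₀` is added to `α`
(`dg₀ = 0`). [folklore] -/
theorem eq_dOne_add_coe (α : C(G, X)) (g₀ : contOneCocycles X) (f : contTwoCocycles X)
    (hf : ∀ σ τ : G, f.1 (σ, τ) = X.ρ σ (α τ) - α (σ * τ) + α σ) (σ τ : G) :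
    f.1 (σ, τ) = X.ρ σ ((α + (g₀ : C(G, X))) τ) - (α + (g₀ : C(G, X))) (σ * τ) +
      (α + (g₀ : C(G, X))) σ := by
  simp only [ContinuousMap.add_apply, map_add]
  rw [hf, g₀.2 σ τ]
  abel

omit [LocallyCompactSpace G] in
/-- **Adding a `1`-cocycle `g₀` to `α` adds `g₀ ∪ g`**: `(α + g₀) ∪ g - ε = (α ∪ g - ε) + g₀ ∪ g`
(Milne, *ADT*, I Prop. 6.9: two choices of the local Kummer lift `β_{v,1}` differ by a cocycle).
[folklore] -/
theorem cupSubCocycle_add_coe (α : C(G, X)) (g₀ : contOneCocycles X) (g : contOneCocycles Y)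
    (f : contTwoCocycles X) (hf : ∀ σ τ : G, f.1 (σ, τ) = X.ρ σ (α τ) - α (σ * τ) + α σ)
    (hf' : ∀ σ τ : G, f.1 (σ, τ) = X.ρ σ ((α + (g₀ : C(G, X))) τ) - (α + (g₀ : C(G, X))) (σ * τ) +
      (α + (g₀ : C(G, X))) σ)
    (ε : C(G × G, Z)) (hε : ∀ σ τ υ : G, (φ.cupCocycle₂₁ f g).1 (σ, τ, υ) = dTwo Z ε σ τ υ) :
    φ.cupSubCocycle (α + (g₀ : C(G, X))) g f hf' ε hε =
      φ.cupSubCocycle α g f hf ε hε + φ.cupCocycle g₀ g :=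
  Subtype.ext (by
    simp only [coe_cupSubCocycle, Submodule.coe_add, cochainCup₁₁_add,
      cochainCup₁₁_coe_contOneCocycles]
    abel)

/-- On classes: `[(α + g₀) ∪ g - ε] = [α ∪ g - ε] + [g₀] ∪ [g]`. [folklore] -/
theorem twoCocycleClass_cupSubCocycle_add_coe (α : C(G, X)) (g₀ : contOneCocycles X)
    (g : contOneCocycles Y) (f : contTwoCocycles X)
    (hf : ∀ σ τ : G, f.1 (σ, τ) = X.ρ σ (α τ) - α (σ * τ) + α σ)
    (hf' : ∀ σ τ : G, f.1 (σ, τ) = X.ρ σ ((α + (g₀ : C(G, X))) τ) - (α + (g₀ : C(G, X))) (σ * τ) +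
      (α + (g₀ : C(G, X))) σ)
    (ε : C(G × G, Z)) (hε : ∀ σ τ υ : G, (φ.cupCocycle₂₁ f g).1 (σ, τ, υ) = dTwo Z ε σ τ υ) :
    twoCocycleClass Z (φ.cupSubCocycle (α + (g₀ : C(G, X))) g f hf' ε hε) =
      twoCocycleClass Z (φ.cupSubCocycle α g f hf ε hε) +
        φ.cupProduct (oneCocycleClass X g₀) (oneCocycleClass Y g) := by
  rw [cupSubCocycle_add_coe φ α g₀ g f hf hf' ε hε, twoCocycleClass_add,
    cupProduct_oneCocycleClass_eq_twoCocycleClass]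

omit [IsTopologicalGroup G] [LocallyCompactSpace G] in
/-- Adding a `2`-cocycle to a `2`-cochain does not change its coboundary. [folklore] -/
theorem dTwo_add_coe (ε : C(G × G, Z)) (c : contTwoCocycles Z) (σ τ υ : G) :
    dTwo Z (ε + (c : C(G × G, Z))) σ τ υ = dTwo Z ε σ τ υ := by
  rw [dTwo_add, dTwo_coe_contTwoCocycles, add_zero]

omit [LocallyCompactSpace G] in
/-- **Adding a `2`-cocycle `c` to `ε` subtracts `c`**: `α ∪ g - (ε + c) = (α ∪ g - ε) - c`
(Milne, *ADT*, I Prop. 6.9: two choices of `ε` with `dε = dβ₁ ∪ β'` differ by a `2`-cocycle).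
[folklore] -/
theorem cupSubCocycle_add_coe_right (α : C(G, X)) (g : contOneCocycles Y) (f : contTwoCocycles X)
    (hf : ∀ σ τ : G, f.1 (σ, τ) = X.ρ σ (α τ) - α (σ * τ) + α σ) (ε : C(G × G, Z))
    (c : contTwoCocycles Z)
    (hε : ∀ σ τ υ : G, (φ.cupCocycle₂₁ f g).1 (σ, τ, υ) = dTwo Z ε σ τ υ)
    (hε' : ∀ σ τ υ : G, (φ.cupCocycle₂₁ f g).1 (σ, τ, υ) = dTwo Z (ε + (c : C(G × G, Z))) σ τ υ) :
    φ.cupSubCocycle α g f hf (ε + (c : C(G × G, Z))) hε' = φ.cupSubCocycle α g f hf ε hε - c :=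
  Subtype.ext (by
    simp only [coe_cupSubCocycle, Submodule.coe_sub]
    abel)

/-- On classes: `[α ∪ g - (ε + c)] = [α ∪ g - ε] - [c]`. [folklore] -/
theorem twoCocycleClass_cupSubCocycle_add_coe_right (α : C(G, X)) (g : contOneCocycles Y)
    (f : contTwoCocycles X) (hf : ∀ σ τ : G, f.1 (σ, τ) = X.ρ σ (α τ) - α (σ * τ) + α σ)
    (ε : C(G × G, Z)) (c : contTwoCocycles Z)
    (hε : ∀ σ τ υ : G, (φ.cupCocycle₂₁ f g).1 (σ, τ, υ) = dTwo Z ε σ τ υ)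
    (hε' : ∀ σ τ υ : G, (φ.cupCocycle₂₁ f g).1 (σ, τ, υ) = dTwo Z (ε + (c : C(G × G, Z))) σ τ υ) :
    twoCocycleClass Z (φ.cupSubCocycle α g f hf (ε + (c : C(G × G, Z))) hε') =
      twoCocycleClass Z (φ.cupSubCocycle α g f hf ε hε) - twoCocycleClass Z c := by
  rw [cupSubCocycle_add_coe_right φ α g f hf ε c hε hε', twoCocycleClass_sub]

omit [LocallyCompactSpace G] in
/-- The boundary condition `f ∪ (g + g') = d(ε + ε')` from those of the summands. [folklore] -/
theorem cupCocycle₂₁_add_right_eq_dTwo (f : contTwoCocycles X) (g g' : contOneCocycles Y)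
    (ε ε' : C(G × G, Z))
    (hε : ∀ σ τ υ : G, (φ.cupCocycle₂₁ f g).1 (σ, τ, υ) = dTwo Z ε σ τ υ)
    (hε' : ∀ σ τ υ : G, (φ.cupCocycle₂₁ f g').1 (σ, τ, υ) = dTwo Z ε' σ τ υ) (σ τ υ : G) :
    (φ.cupCocycle₂₁ f (g + g')).1 (σ, τ, υ) = dTwo Z (ε + ε') σ τ υ := by
  rw [cupCocycle₂₁_add_right, dTwo_add, ← hε, ← hε']
  rfl

omit [LocallyCompactSpace G] in
/-- **Additivity in `(g, ε)`**: `α ∪ (g + g') - (ε + ε') = (α ∪ g - ε) + (α ∪ g' - ε')`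
(bi-additivity of the Cassels–Tate pairing in the second variable, Milne, *ADT*, I Prop. 6.9).
[folklore] -/
theorem cupSubCocycle_add_right (α : C(G, X)) (g g' : contOneCocycles Y) (f : contTwoCocycles X)
    (hf : ∀ σ τ : G, f.1 (σ, τ) = X.ρ σ (α τ) - α (σ * τ) + α σ) (ε ε' : C(G × G, Z))
    (hε : ∀ σ τ υ : G, (φ.cupCocycle₂₁ f g).1 (σ, τ, υ) = dTwo Z ε σ τ υ)
    (hε' : ∀ σ τ υ : G, (φ.cupCocycle₂₁ f g').1 (σ, τ, υ) = dTwo Z ε' σ τ υ)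
    (hε'' : ∀ σ τ υ : G, (φ.cupCocycle₂₁ f (g + g')).1 (σ, τ, υ) = dTwo Z (ε + ε') σ τ υ) :
    φ.cupSubCocycle α (g + g') f hf (ε + ε') hε'' =
      φ.cupSubCocycle α g f hf ε hε + φ.cupSubCocycle α g' f hf ε' hε' :=
  Subtype.ext (by
    simp only [coe_cupSubCocycle, Submodule.coe_add, cochainCup₁₁_add_right]
    abel)

omit [IsTopologicalGroup G] [LocallyCompactSpace G] in
/-- The coboundary formula for a sum: `f + f' = d(α + α')`. [folklore] -/
theorem add_eq_dOne_add (α α' : C(G, X)) (f f' : contTwoCocycles X)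
    (hf : ∀ σ τ : G, f.1 (σ, τ) = X.ρ σ (α τ) - α (σ * τ) + α σ)
    (hf' : ∀ σ τ : G, f'.1 (σ, τ) = X.ρ σ (α' τ) - α' (σ * τ) + α' σ) (σ τ : G) :
    (f + f').1 (σ, τ) = X.ρ σ ((α + α') τ) - (α + α') (σ * τ) + (α + α') σ := by
  rw [Submodule.coe_add, ContinuousMap.add_apply, hf, hf']
  simp only [ContinuousMap.add_apply, map_add]
  abel

omit [LocallyCompactSpace G] in
/-- The boundary condition `(f + f') ∪ g = d(ε + ε')` from those of the summands. [folklore] -/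
theorem cupCocycle₂₁_add_left_eq_dTwo (f f' : contTwoCocycles X) (g : contOneCocycles Y)
    (ε ε' : C(G × G, Z))
    (hε : ∀ σ τ υ : G, (φ.cupCocycle₂₁ f g).1 (σ, τ, υ) = dTwo Z ε σ τ υ)
    (hε' : ∀ σ τ υ : G, (φ.cupCocycle₂₁ f' g).1 (σ, τ, υ) = dTwo Z ε' σ τ υ) (σ τ υ : G) :
    (φ.cupCocycle₂₁ (f + f') g).1 (σ, τ, υ) = dTwo Z (ε + ε') σ τ υ := by
  rw [cupCocycle₂₁_add_left, dTwo_add, ← hε, ← hε']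
  rfl

omit [LocallyCompactSpace G] in
/-- **Additivity in `(α, f, ε)`**: `(α + α') ∪ g - (ε + ε') = (α ∪ g - ε) + (α' ∪ g - ε')`
(bi-additivity of the Cassels–Tate pairing in the first variable, Milne, *ADT*, I Prop. 6.9).
[folklore] -/
theorem cupSubCocycle_add_left (α α' : C(G, X)) (g : contOneCocycles Y) (f f' : contTwoCocycles X)
    (hf : ∀ σ τ : G, f.1 (σ, τ) = X.ρ σ (α τ) - α (σ * τ) + α σ)
    (hf' : ∀ σ τ : G, f'.1 (σ, τ) = X.ρ σ (α' τ) - α' (σ * τ) + α' σ)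
    (hf'' : ∀ σ τ : G, (f + f').1 (σ, τ) = X.ρ σ ((α + α') τ) - (α + α') (σ * τ) + (α + α') σ)
    (ε ε' : C(G × G, Z))
    (hε : ∀ σ τ υ : G, (φ.cupCocycle₂₁ f g).1 (σ, τ, υ) = dTwo Z ε σ τ υ)
    (hε' : ∀ σ τ υ : G, (φ.cupCocycle₂₁ f' g).1 (σ, τ, υ) = dTwo Z ε' σ τ υ)
    (hε'' : ∀ σ τ υ : G, (φ.cupCocycle₂₁ (f + f') g).1 (σ, τ, υ) = dTwo Z (ε + ε') σ τ υ) :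
    φ.cupSubCocycle (α + α') g (f + f') hf'' (ε + ε') hε'' =
      φ.cupSubCocycle α g f hf ε hε + φ.cupSubCocycle α' g f' hf' ε' hε' :=
  Subtype.ext (by
    simp only [coe_cupSubCocycle, Submodule.coe_add, cochainCup₁₁_add]
    abel)

omit [IsTopologicalGroup G] [LocallyCompactSpace G] in
/-- If `f = dα` and `f' = d(α + γ)` then `f' - f = dγ`. [folklore] -/
theorem sub_eq_dOne_of_eq_dOne_add (α γ : C(G, X)) (f f' : contTwoCocycles X)
    (hf : ∀ σ τ : G, f.1 (σ, τ) = X.ρ σ (α τ) - α (σ * τ) + α σ)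
    (hf' : ∀ σ τ : G, f'.1 (σ, τ) = X.ρ σ ((α + γ) τ) - (α + γ) (σ * τ) + (α + γ) σ) (σ τ : G) :
    (f' - f).1 (σ, τ) = X.ρ σ (γ τ) - γ (σ * τ) + γ σ := by
  rw [Submodule.coe_sub, ContinuousMap.sub_apply, hf, hf']
  simp only [ContinuousMap.add_apply, map_add]
  abel

omit [LocallyCompactSpace G] in
/-- The boundary condition after the change `(α, ε) ↦ (α + γ, ε + γ ∪ g)`: if `f ∪ g = dε`,
`f = dα` and `f' = d(α + γ)`, then `f' ∪ g = d(ε + γ ∪ g)` (Leibniz rule `d(γ ∪ g) = dγ ∪ g`).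
[folklore] -/
theorem cupCocycle₂₁_eq_dTwo_add_cochainCup₁₁ (α γ : C(G, X)) (g : contOneCocycles Y)
    (f f' : contTwoCocycles X)
    (hf : ∀ σ τ : G, f.1 (σ, τ) = X.ρ σ (α τ) - α (σ * τ) + α σ)
    (hf' : ∀ σ τ : G, f'.1 (σ, τ) = X.ρ σ ((α + γ) τ) - (α + γ) (σ * τ) + (α + γ) σ)
    (ε : C(G × G, Z)) (hε : ∀ σ τ υ : G, (φ.cupCocycle₂₁ f g).1 (σ, τ, υ) = dTwo Z ε σ τ υ)
    (σ τ υ : G) :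
    (φ.cupCocycle₂₁ f' g).1 (σ, τ, υ) = dTwo Z (ε + φ.cochainCup₁₁ γ g) σ τ υ := by
  have h : f' = f + (f' - f) := (add_sub_cancel f f').symm
  rw [h, cupCocycle₂₁_add_left, dTwo_add, ← hε,
    dTwo_cochainCup₁₁ φ γ g (f' - f) (sub_eq_dOne_of_eq_dOne_add α γ f f' hf hf')]
  rfl

omit [LocallyCompactSpace G] in
/-- **Changing `(α, ε)` to `(α + γ, ε + γ ∪ g)` does not change the cocycle**:
`(α + γ) ∪ g - (ε + γ ∪ g) = α ∪ g - ε` for ANY `1`-cochain `γ` (Milne, *ADT*, I Prop. 6.9: the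
cochain lift `β₁` of `β` may be changed by `ι ∘ γ`, changing `dβ₁` by `ι ∘ dγ` and `ε` by `γ ∪ β'`).
[folklore] -/
theorem cupSubCocycle_add_cochainCup₁₁ (α γ : C(G, X)) (g : contOneCocycles Y)
    (f f' : contTwoCocycles X)
    (hf : ∀ σ τ : G, f.1 (σ, τ) = X.ρ σ (α τ) - α (σ * τ) + α σ)
    (hf' : ∀ σ τ : G, f'.1 (σ, τ) = X.ρ σ ((α + γ) τ) - (α + γ) (σ * τ) + (α + γ) σ)
    (ε : C(G × G, Z)) (hε : ∀ σ τ υ : G, (φ.cupCocycle₂₁ f g).1 (σ, τ, υ) = dTwo Z ε σ τ υ)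
    (hε' : ∀ σ τ υ : G, (φ.cupCocycle₂₁ f' g).1 (σ, τ, υ) = dTwo Z (ε + φ.cochainCup₁₁ γ g) σ τ υ) :
    φ.cupSubCocycle (α + γ) g f' hf' (ε + φ.cochainCup₁₁ γ g) hε' = φ.cupSubCocycle α g f hf ε hε :=
  Subtype.ext (by
    simp only [coe_cupSubCocycle, cochainCup₁₁_add]
    abel)

end ContPairing

end Literature.NumberTheory.GaloisRepresentations

end
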